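import Summits.NavierStokesRegularity.NavierStokesRegularity.Theorems.ScenarioCensusRowA7h
import Literature.Analysis.FluidPDE.KNSSRemark61
import Literature.Analysis.FluidPDE.KNSSLemma31Liouville
import Literature.Analysis.FluidPDE.AncientMildDrift
import Literature.Analysis.FluidPDE.SelfSimilarLiouville

/-!
# Census row A7hb (bounded horizontal-valued ancient mild flows, KNSS gauge) — part 3: the A7hb obligations,
# the census parent A1 BY NAME, planar rigidity (B2a)

Re-homed for the scenario census (typer seat; lead §6 v1.54 «part 6») from ns-idea-2's landing extract
`pub/ideators/ns-idea-2/lines/horizontal-meter/landing/HorizontalValuedAncientLiouville.lean` (LINE «horizontal-meter»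
REV 6; sha16 e96b1ff5a9ad1d2e, rc 0, 0 sorry) — the DELTA over parts 1–2 (`ScenarioCensusRowA7hExtinction`,
`ScenarioCensusRowA7h`, which re-homed rev 3), in two files for the 400-line rule: this file and
`ScenarioCensusRowA7hbShear` (B2b `shearIsConstant`, B2 `curlFreeHorizontalIsConstant_holds`, `row_A7hb_of_B1`).
Lean text verbatim in namespace `…ScenarioCensus.HorizontalMeter` (the line's `ℝ³` / `ℝ²` notation spelled out).

Contents: the hypothesis-style obligations B1 `VerticalVorticityVanishesBounded` (OPEN: bounded gauge class,
`u₃ ≡ 0` ⇒ `ω₃ ≡ 0`), B2 `CurlFreeHorizontalIsConstant`, B2b `ShearIsConstant`; `row_A7hb_of_stubs` (B1 → B2 ⇒ A7hb);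
the gauge class is a subclass of the census duality class (`IsBoundedKNSSMild.isMildNSSolutionBetween`,
`.isBoundedAncientMildSolution`, `.aestronglyMeasurable_slice`) and the census PARENT BY NAME
`row_A7hb_of_row_A1 : ScenarioCensus.Row_A1 → Row_A7hb` (A7hb ⊆ A1; KNSS Remark 6.1); B2a `planarRigidity`
(PROVED: `u₃ ≡ 0`, `ω₃ ≡ 0`, bounded ⇒ slices constant on horizontal planes — planar harmonic Liouville one
dimension up via the tree's `apply_eq_apply_of_symm_fderiv_of_isDivFree_of_bounded` on `ℝ²`; horizontal
projection / embedding `P2` / `J2`); `curlFreeHorizontalIsConstant_of_shearIsConstant`, `row_A7hb_of_stubs'`.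

No census value is asserted here (A7hb stays OPEN until B1 is a tree theorem; the lead books values); NS regularity
is NOT proved; no summit statement is proved by this file.
-/

set_option linter.dupNamespace false

noncomputable section

namespace Summit.NavierStokesRegularity.NavierStokesRegularity.Theorems.ScenarioCensus.HorizontalMeter

open Set Function Filter Topology MeasureTheory
open scoped RealInnerProductSpace InnerProductSpace NNReal Laplacian
open Literature.Analysis Literature.Analysis.FluidPDE
open Summit.NavierStokesRegularity.NavierStokesRegularity

/-! ## Obligations for row A7hb (hypothesis-style `Prop`s) -/

/-- **B1 (crux, M) — vertical vorticity vanishes, bounded class.**  Same conclusion WITHOUT a rate: `ω₃` is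
a bounded ancient solution of the stretching-free drift–diffusion equation with bounded divergence-free
drift; if `sup ω₃ = M₁ > 0`, KNSS Lemma 2.1 yields parabolic cylinders of arbitrarily large radius `R` on
which `ω₃ ≥ M₁/2`; on a horizontal disc `D_R` inside one of them Stokes' theorem gives
`(M₁/2)·πR² ≤ ∫_{D_R} ω₃ = ∮_{∂D_R} u_h·τ ≤ 2πR·sup‖u‖` — absurd for large `R`; symmetrically for `−ω₃`.
(KNSS regularity supplies the bounded gradient.)  [KNSS2009 Lemma 2.1 (arXiv:0709.3599 p.5), proof of
Thm 5.1 (p.9); tree `KNSS2009_lemma21_halfball`, `KNSSRegularityPlanar`] -/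
def VerticalVorticityVanishesBounded : Prop :=
  ∀ u : ℝ → (EuclideanSpace ℝ (Fin 3)) → (EuclideanSpace ℝ (Fin 3)), IsBoundedKNSSMild u → IsHorizontalValued u → ∀ t < 0, ∀ y, ⟪curl (u t) y, e3⟫_ℝ = 0


/-- **B2 (crux, M) — curl-free horizontal bounded ancient flows are constants.**  With `u·e₃ ≡ 0`,
`div u = 0` and `ω₃ ≡ 0`, every horizontal plane carries a bounded `C²` planar field with symmetric
Jacobian and zero divergence, hence constant on that plane (tree
`apply_eq_apply_of_symm_fderiv_of_isDivFree_of_bounded` on `(EuclideanSpace ℝ (Fin 2))`): `u = (b₀, b₁, 0)(t, x₂)` is a SHEAR FLOW.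
For a shear flow `∇·(u ⊗ u) = (u·∇)u ≡ 0`, so the Oseen–Duhamel term vanishes (integrate by parts on balls,
kernel `O(|y|⁻³)`), `u(t) = e^{(t−s)Δ}u(s)` for all `s < t < 0`; the smoothing bound
`‖∇e^{τΔ}f‖_∞ ≤ c τ^{−1/2}‖f‖_∞` with `τ = t − s → ∞` kills `∇u(t)`, and the gauge identity makes the
spatial constant time-independent.  [KNSS2009 Lemma 3.1 / §4; tree `KNSSLemma31Liouville`,
`NSBoundedMildOseenDuhamel`] -/
def CurlFreeHorizontalIsConstant : Prop :=
  ∀ u : ℝ → (EuclideanSpace ℝ (Fin 3)) → (EuclideanSpace ℝ (Fin 3)), IsBoundedKNSSMild u → IsHorizontalValued u →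
    (∀ t < 0, ∀ y, ⟪curl (u t) y, e3⟫_ℝ = 0) → ∃ b : (EuclideanSpace ℝ (Fin 3)), ∀ t < 0, ∀ x, u t x = b

/-- **Obligation B2b — PROVED below (`shearIsConstant`, REV 6; it replaced B2 as the registered stub at
REV 5, and B2 is DERIVED from B2b and the proved planar rigidity B2a)** — shear-structured members are
constant: a bounded KNSS-gauge ancient mild field with `u₃ ≡ 0` whose slices are constant on horizontal
planes, `u(t,x) = b(t, x₃)`, is one constant.  [Proof, all from the tree: the nonlinear integrand of the
duality identity vanishes on a horizontal shear slice (`integral_inner_fderiv_heatTest_apply_eq_zero_of_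
ae_invariant`), so the identity is caloric; `L¹` decay of caloric solenoidal tests
(`exists_integral_norm_heatTest_le_of_isDivFree`) kills every solenoidal pairing of a slice; the bounded
annihilator lemma (`IsWeaklyDivFree.exists_ae_eq_const_of_norm_le_of_forall_integral_inner_eq_zero`)
makes the slice a.e. constant; continuity and KNSS Remark 6.1 (`KNSS2009_remark61`) finish.] -/
def ShearIsConstant : Prop :=
  ∀ u : ℝ → (EuclideanSpace ℝ (Fin 3)) → (EuclideanSpace ℝ (Fin 3)), IsBoundedKNSSMild u → IsHorizontalValued u →
    (∀ t < 0, ∀ x y : (EuclideanSpace ℝ (Fin 3)), x 2 = y 2 → u t x = u t y) → ∃ b : (EuclideanSpace ℝ (Fin 3)), ∀ t < 0, ∀ x, u t x = b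


/-! ## Composition -/

/-- **Rung 1b**: B1 → B2 ⇒ Row A7hb. -/
theorem row_A7hb_of_stubs (hB1 : VerticalVorticityVanishesBounded) (hB2 : CurlFreeHorizontalIsConstant) :
    Row_A7hb :=
  fun u hu hh => hB2 u hu hh (hB1 u hu hh)

/-! ### Price P1 (critic 13:54Z): the census PARENT of rung 1b, BY NAME

`Row_A7hb` is typed over the line-local KNSS-gauge class `IsBoundedKNSSMild`; the census's bounded
rows quantify over the tree class `FluidPDE.IsBoundedAncientMildSolution 1 u` with measurable slices
and a.e. conclusions (A1 = `LiouvilleConjectureNS`).  The gauge class is a SUBCLASS (Oseen integral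
form ⇒ two-time duality form, exactly as `IsTypeIAncientMild.isMildNSSolutionBetween`), its slices are
continuous, and slice-constant members are time-independent (KNSS Remark 6.1, tree
`KNSS2009_remark61`); hence `LiouvilleConjectureNS → Row_A7hb`. -/

/-- The KNSS-gauge bounded class satisfies the two-time duality identity (port of
`IsTypeIAncientMild.isMildNSSolutionBetween` with the bound `B` in place of `C/√(−t)`). -/
theorem IsBoundedKNSSMild.isMildNSSolutionBetween {u : ℝ → (EuclideanSpace ℝ (Fin 3)) → (EuclideanSpace ℝ (Fin 3))} (h : IsBoundedKNSSMild u)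
    {s t : ℝ} (hst : s < t) (ht : t < 0) : IsMildNSSolutionBetween 1 0 u s t := by
  obtain ⟨hsm, hdv, hmild, B, hBd⟩ := h
  have hS : IsSmoothSpaceTimeOn (Iio 0) u := hsm
  intro φ hφ hdiv
  have hs : s < 0 := hst.trans ht
  have hM : 0 ≤ B := (norm_nonneg _).trans (hBd (-1) (by norm_num) 0)
  have huM : ∀ τ ∈ Ioo s t, ∀ y, ‖u τ y‖ ≤ B := fun τ hτ y => hBd τ (hτ.2.trans ht) y
  have hmeas : AEStronglyMeasurable (uncurry u)
      ((volume : Measure (ℝ × (EuclideanSpace ℝ (Fin 3)))).restrict (Ioo s t ×ˢ univ)) :=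
    (hS.continuousOn.mono
      (prod_mono (fun _ hτ => lt_of_lt_of_le hτ.2 ht.le) subset_rfl)).aestronglyMeasurable
      (measurableSet_Ioo.prod MeasurableSet.univ)
  have hcs : Continuous (u s) := (hS.contDiff_slice hs).continuous
  have hct : Continuous (u t) := (hS.contDiff_slice ht).continuous
  have hφc : Continuous φ := hφ.contDiff.continuous
  -- the three tested identities
  have hB := integral_inner_oseenDuhamel_eq_neg_intervalIntegral one_pos hmeas hM huM hst le_rfl
    hφ hdiv
  have hA := integral_inner_heatExtension_comm_of_bound hcs.aestronglyMeasurable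
    (fun x => hBd s hs x) hφc hφ.hasCompactSupport (sub_pos.2 hst)
  have hut : ∀ x, u t x =
      UnboundedOperators.heatExtension (u s) (t - s) x - oseenDuhamel 1 s u u t x := fun x => by
    rw [hmild s t hst ht x, heatFlow_of_pos _ (sub_pos.2 hst)]
  -- integrability of the three pairings
  obtain ⟨K, -, hK⟩ := exists_norm_oseenDuhamel_bounded_le (E := (EuclideanSpace ℝ (Fin 3)))
  have hiB : Integrable (fun x => ⟪oseenDuhamel 1 s u u t x, φ x⟫) (volume : Measure (EuclideanSpace ℝ (Fin 3))) :=
    integrable_inner_of_norm_le_of_hasCompactSupport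
      (aestronglyMeasurable_oseenDuhamel one_pos hmeas hmeas hM huM huM hst le_rfl)
      (fun x => hK one_pos hst hM huM huM x) hφc hφ.hasCompactSupport
  have hiU : Integrable (fun x => ⟪u t x, φ x⟫) (volume : Measure (EuclideanSpace ℝ (Fin 3))) :=
    integrable_inner_of_continuous_of_hasCompactSupport hct hφc hφ.hasCompactSupport
  have hiA : Integrable
      (fun x => ⟪UnboundedOperators.heatExtension (u s) (t - s) x, φ x⟫) (volume : Measure (EuclideanSpace ℝ (Fin 3))) := by
    refine (hiU.add hiB).congr (Eventually.of_forall fun x => ?_)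
    simp only [Pi.add_apply, hut x, inner_sub_left, sub_add_cancel]
  -- assemble
  calc ∫ x, ⟪u t x, φ x⟫
      = ∫ x, (⟪UnboundedOperators.heatExtension (u s) (t - s) x, φ x⟫ -
          ⟪oseenDuhamel 1 s u u t x, φ x⟫) := by
        refine integral_congr_ae (Eventually.of_forall fun x => ?_)
        simp only [hut x, inner_sub_left]
    _ = (∫ x, ⟪UnboundedOperators.heatExtension (u s) (t - s) x, φ x⟫) -
          ∫ x, ⟪oseenDuhamel 1 s u u t x, φ x⟫ := integral_sub hiA hiB
    _ = (∫ x, ⟪u s x, heatTest 1 φ (t - s) x⟫) +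
          (∫ τ in s..t, ∫ x, ⟪u τ x, convect (u τ) (heatTest 1 φ (t - τ)) x⟫) +
          ∫ τ in s..t, ∫ x, ⟪(0 : ℝ → (EuclideanSpace ℝ (Fin 3)) → (EuclideanSpace ℝ (Fin 3))) τ x, heatTest 1 φ (t - τ) x⟫ := by
        rw [hA, hB, heatTest_of_pos one_pos (sub_pos.2 hst), one_mul]
        simp

/-- **The gauge class is a subclass of the census class**: a bounded KNSS-gauge mild field is a
bounded ancient mild solution in the duality sense (`FluidPDE.IsBoundedAncientMildSolution 1 u`). -/
theorem IsBoundedKNSSMild.isBoundedAncientMildSolution {u : ℝ → (EuclideanSpace ℝ (Fin 3)) → (EuclideanSpace ℝ (Fin 3))} (h : IsBoundedKNSSMild u) :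
    IsBoundedAncientMildSolution 1 u := by
  have hS : IsSmoothSpaceTimeOn (Iio 0) u := h.1
  refine ⟨⟨fun t ht => ?_, fun s t hst ht => h.isMildNSSolutionBetween hst ht⟩, ?_⟩
  · exact VectorCalculus.IsDivFree.isWeaklyDivFree_holds (h.2.1 t ht)
      ((hS.contDiff_slice ht).of_le (by exact_mod_cast le_top))
  · obtain ⟨B, hB⟩ := h.2.2.2
    exact ⟨B, fun t ht x => hB t ht x⟩

/-- Slices of the gauge class are a.e. strongly measurable (continuous). -/
theorem IsBoundedKNSSMild.aestronglyMeasurable_slice {u : ℝ → (EuclideanSpace ℝ (Fin 3)) → (EuclideanSpace ℝ (Fin 3))} (h : IsBoundedKNSSMild u)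
    {t : ℝ} (ht : t < 0) : AEStronglyMeasurable (u t) (volume : Measure (EuclideanSpace ℝ (Fin 3))) := by
  have hS : IsSmoothSpaceTimeOn (Iio 0) u := h.1
  exact (hS.contDiff_slice ht).continuous.aestronglyMeasurable

/-- **P1 PAID: the census parent of rung 1b by name** — the Liouville conjecture (L) for bounded
ancient mild solutions (`LiouvilleConjectureNS`, census A1) implies `Row_A7hb` (a.e. constancy ⇒
pointwise constancy by continuity, `Continuous.ae_eq_iff_eq`; time-independence of the constant by
KNSS Remark 6.1, tree `KNSS2009_remark61`, the Duhamel term of a slice-constant field vanishing). -/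
theorem row_A7hb_of_liouvilleConjectureNS
    (hL : Summit.NavierStokesRegularity.NavierStokesRegularity.LiouvilleConjectureNS) : Row_A7hb := by
  intro u hu _hh
  have hS : IsSmoothSpaceTimeOn (Iio 0) u := hu.1
  have hae := hL u hu.isBoundedAncientMildSolution (fun t ht => hu.aestronglyMeasurable_slice ht)
  choose b hb using hae
  -- pointwise constancy of each slice
  have hub : ∀ t (ht : t < 0), ∀ x, u t x = b t ht := by
    intro t ht x
    have hc : Continuous (u t) := (hS.contDiff_slice ht).continuous
    have e : u t = fun _ => b t ht := (Continuous.ae_eq_iff_eq volume hc continuous_const).1 (hb t ht)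
    exact congrFun e x
  -- a total version of `b`
  classical
  set b' : ℝ → (EuclideanSpace ℝ (Fin 3)) := fun t => if ht : t < 0 then b t ht else 0 with hb'
  have hub' : ∀ t < 0, ∀ x, u t x = b' t := by
    intro t ht x
    simp only [hb', dif_pos ht]
    exact hub t ht x
  -- time independence (KNSS Remark 6.1)
  have hconst := KNSS2009_remark61 one_pos hub' (fun s' t' hst' ht' =>
    Eventually.of_forall fun x => by
      rw [one_mul, hu.2.2.1 s' t' hst' ht' x, heatFlow_of_pos _ (sub_pos.2 hst')])
  refine ⟨b' (-1), fun t ht x => ?_⟩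
  rw [hub' t ht x]
  exact hconst t (-1) ht (by norm_num)


/-- The same bridge keyed to the census row A1 BY NAME (`Theorems.ScenarioCensus.Row_A1` is by
definition the canonical leaf `Summit.NavierStokesRegularity.NavierStokesRegularity.LiouvilleConjectureNS`). -/
theorem row_A7hb_of_row_A1 (h : Theorems.ScenarioCensus.Row_A1) : Row_A7hb :=
  row_A7hb_of_liouvilleConjectureNS h


/-! ### B2a — planar rigidity (PROVED, REV 5): `ω₃ ≡ 0` + horizontal + bounded ⇒ slices are constant
on horizontal planes (planar harmonic Liouville, one dimension up, via the tree's
`apply_eq_apply_of_symm_fderiv_of_isDivFree_of_bounded` on `(EuclideanSpace ℝ (Fin 2))`) -/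


/-- Horizontal projection `(EuclideanSpace ℝ (Fin 3)) → (EuclideanSpace ℝ (Fin 2))`. -/
def P2 : (EuclideanSpace ℝ (Fin 3)) →L[ℝ] (EuclideanSpace ℝ (Fin 2)) :=
  (EuclideanSpace.equiv (Fin 2) ℝ).symm.toContinuousLinearMap.comp
    (ContinuousLinearMap.pi fun i : Fin 2 => EuclideanSpace.proj (Fin.castSucc i))

/-- Horizontal embedding `(EuclideanSpace ℝ (Fin 2)) → (EuclideanSpace ℝ (Fin 3))`. -/
def J2 : (EuclideanSpace ℝ (Fin 2)) →L[ℝ] (EuclideanSpace ℝ (Fin 3)) :=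
  (EuclideanSpace.equiv (Fin 3) ℝ).symm.toContinuousLinearMap.comp
    (ContinuousLinearMap.pi fun i : Fin 3 =>
      if h : (i : ℕ) < 2 then EuclideanSpace.proj (⟨i, h⟩ : Fin 2) else 0)

/-- Components of the horizontal projection. -/
theorem P2_apply (w : (EuclideanSpace ℝ (Fin 3))) (i : Fin 2) : P2 w i = w (Fin.castSucc i) := by
  simp [P2]

/-- First component of the horizontal embedding. -/
theorem J2_apply_zero (z : (EuclideanSpace ℝ (Fin 2))) : J2 z 0 = z 0 := by simp [J2]
/-- Second component of the horizontal embedding. -/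
theorem J2_apply_one (z : (EuclideanSpace ℝ (Fin 2))) : J2 z 1 = z 1 := by simp [J2]
/-- The horizontal embedding has vanishing third component. -/
theorem J2_apply_two (z : (EuclideanSpace ℝ (Fin 2))) : J2 z 2 = 0 := by simp [J2]

/-- `P2` and `J2` are adjoint. -/
theorem inner_P2_left (w : (EuclideanSpace ℝ (Fin 3))) (b : (EuclideanSpace ℝ (Fin 2))) : inner ℝ (P2 w) b = inner ℝ w (J2 b) := by
  simp [PiLp.inner_apply, Fin.sum_univ_two, Fin.sum_univ_three, P2_apply, J2_apply_zero, J2_apply_one,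
    J2_apply_two]

/-- `J2 ∘ P2` is the identity on horizontal vectors. -/
theorem J2_P2_of_zero (w : (EuclideanSpace ℝ (Fin 3))) (hw : w 2 = 0) : J2 (P2 w) = w := by
  ext i
  fin_cases i
  · simp [J2_apply_zero, P2_apply]
  · simp [J2_apply_one, P2_apply]
  · simp [J2_apply_two, hw]

/-- `J2` in the standard basis. -/
theorem J2_eq (a : (EuclideanSpace ℝ (Fin 2))) :
    J2 a = a 0 • EuclideanSpace.single (0 : Fin 3) (1 : ℝ) + a 1 • EuclideanSpace.single 1 1 := by
  ext i
  fin_cases i <;> simp [J2_apply_zero, J2_apply_one, J2_apply_two]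

/-- `J2 e₀ = e₀`. -/
theorem J2_single_zero : J2 (EuclideanSpace.single 0 1) = EuclideanSpace.single (0 : Fin 3) (1 : ℝ) := by
  rw [J2_eq]; simp

/-- `J2 e₁ = e₁`. -/
theorem J2_single_one : J2 (EuclideanSpace.single 1 1) = EuclideanSpace.single (1 : Fin 3) (1 : ℝ) := by
  rw [J2_eq]; simp

/-- **Planar Liouville for one slice**: a bounded `C²` divergence-free field on `(EuclideanSpace ℝ (Fin 3))` with `v·e₃ ≡ 0`
and `ω₃ ≡ 0` is constant on every horizontal plane: the planar field `z ↦ P2 (v (J2 z + x))` is `C²`,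
bounded, divergence free (`∂₃v₃ = 0`) and has symmetric gradient (`ω₃ = 0`), so the tree's
harmonic Liouville theorem `apply_eq_apply_of_symm_fderiv_of_isDivFree_of_bounded` applies. -/
theorem planarRigidity_slice {v : (EuclideanSpace ℝ (Fin 3)) → (EuclideanSpace ℝ (Fin 3))} (hv : ContDiff ℝ 2 v) {B : ℝ} (hB : ∀ x, ‖v x‖ ≤ B)
    (hdiv : VectorCalculus.IsDivFree v) (hh : ∀ x, v x 2 = 0)
    (hω : ∀ x, curl v x 2 = 0) (x y : (EuclideanSpace ℝ (Fin 3))) (hxy : x 2 = y 2) : v x = v y := by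
  have hd : ∀ w, DifferentiableAt ℝ v w := fun w => (hv.differentiable (by norm_num)) w
  -- flatness of the third component
  have hflat : ∀ w a, fderiv ℝ v w a 2 = 0 := by
    intro w a
    set L : (EuclideanSpace ℝ (Fin 3)) →L[ℝ] ℝ := EuclideanSpace.proj (2 : Fin 3) with hL
    have hcomp : HasFDerivAt (fun z => L (v z)) (L.comp (fderiv ℝ v w)) w :=
      L.hasFDerivAt.comp w (hd w).hasFDerivAt
    have hzero : (fun z => L (v z)) = fun _ => (0 : ℝ) := by
      funext z; simp [hL, hh z]
    rw [hzero] at hcomp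
    have h3 : L.comp (fderiv ℝ v w) = 0 := by rw [← hcomp.fderiv]; simp
    have h4 := congrArg (fun T : (EuclideanSpace ℝ (Fin 3)) →L[ℝ] ℝ => T a) h3
    simpa [hL] using h4
  -- the planar field through the base point `x`
  set V : (EuclideanSpace ℝ (Fin 2)) → (EuclideanSpace ℝ (Fin 2)) := fun z => P2 (v (J2 z + x)) with hVdef
  have haff : ∀ z : (EuclideanSpace ℝ (Fin 2)), HasFDerivAt (fun z : (EuclideanSpace ℝ (Fin 2)) => J2 z + x) J2 z := fun z =>
    J2.hasFDerivAt.add_const x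
  have hVd : ∀ z, HasFDerivAt V (P2.comp ((fderiv ℝ v (J2 z + x)).comp J2)) z := by
    intro z
    exact P2.hasFDerivAt.comp z ((hd (J2 z + x)).hasFDerivAt.comp z (haff z))
  have hVf : ∀ z a, fderiv ℝ V z a = P2 (fderiv ℝ v (J2 z + x) (J2 a)) := fun z a => by
    rw [(hVd z).fderiv]; rfl
  have hV2 : ContDiff ℝ 2 V := P2.contDiff.comp (hv.comp (J2.contDiff.add contDiff_const))
  have key : ∀ (w : (EuclideanSpace ℝ (Fin 3))) (a c : (EuclideanSpace ℝ (Fin 2))),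
      inner ℝ (fderiv ℝ v w (J2 a)) (J2 c) = inner ℝ (fderiv ℝ v w (J2 c)) (J2 a) := by
    intro w a c
    have hcurl : fderiv ℝ v w (EuclideanSpace.single 0 1) 1 -
        fderiv ℝ v w (EuclideanSpace.single 1 1) 0 = 0 := by
      have := hω w
      simpa [curl] using this
    have hD : fderiv ℝ v w (EuclideanSpace.single 0 1) 1 =
        fderiv ℝ v w (EuclideanSpace.single 1 1) 0 := sub_eq_zero.1 hcurl
    rw [J2_eq a, J2_eq c]
    simp only [map_add, map_smul]
    simp [PiLp.inner_apply, Fin.sum_univ_three, hD]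
    ring
  have hsymm : ∀ z a c, inner ℝ (fderiv ℝ V z a) c = inner ℝ (fderiv ℝ V z c) a := by
    intro z a c
    rw [hVf, hVf, inner_P2_left, inner_P2_left]
    exact key _ a c
  have hdivV : VectorCalculus.IsDivFree V := by
    intro z
    rw [divergence_eq_sum_inner_fderiv (EuclideanSpace.basisFun (Fin 2) ℝ)]
    have h3 := hdiv (J2 z + x)
    rw [divergence_eq_sum_inner_fderiv (EuclideanSpace.basisFun (Fin 3) ℝ)] at h3
    simp only [Fin.sum_univ_two, Fin.sum_univ_three, EuclideanSpace.basisFun_apply,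
      EuclideanSpace.inner_single_left, one_mul, RCLike.conj_to_real, hVf, P2_apply,
      J2_single_zero, J2_single_one] at h3 ⊢
    have h22 := hflat (J2 z + x) (EuclideanSpace.single 2 1)
    simp only [Fin.castSucc_zero, Fin.castSucc_one] at *
    linarith [h3, h22]
  have hbd : ∀ z, ‖V z‖ ≤ ‖P2‖ * B := fun z =>
    (P2.le_opNorm _).trans (mul_le_mul_of_nonneg_left (hB _) (norm_nonneg _))
  have hconst :=
    apply_eq_apply_of_symm_fderiv_of_isDivFree_of_bounded hV2 hsymm hdivV hbd 0 (P2 (y - x))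
  -- read off
  have h0 : V 0 = P2 (v x) := by
    show P2 (v (J2 0 + x)) = P2 (v x)
    rw [map_zero, zero_add]
  have h1 : V (P2 (y - x)) = P2 (v y) := by
    have : (y - x) 2 = 0 := by simp [hxy]
    show P2 (v (J2 (P2 (y - x)) + x)) = P2 (v y)
    rw [J2_P2_of_zero _ this, sub_add_cancel]
  rw [h0, h1] at hconst
  ext i
  fin_cases i
  · simpa [P2_apply] using congrArg (fun w : (EuclideanSpace ℝ (Fin 2)) => w 0) hconst
  · simpa [P2_apply] using congrArg (fun w : (EuclideanSpace ℝ (Fin 2)) => w 1) hconst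
  · simp [hh x, hh y]

/-- **B2a (PROVED)**: in the bounded KNSS-gauge class, `u₃ ≡ 0` and `ω₃ ≡ 0` force every slice to be
constant on horizontal planes, `u(t,x) = b(t, x₃)`. -/
theorem planarRigidity {u : ℝ → (EuclideanSpace ℝ (Fin 3)) → (EuclideanSpace ℝ (Fin 3))} (hu : IsBoundedKNSSMild u) (hh : IsHorizontalValued u)
    (hω : ∀ t < 0, ∀ y, ⟪curl (u t) y, e3⟫_ℝ = 0) :
    ∀ t < 0, ∀ x y : (EuclideanSpace ℝ (Fin 3)), x 2 = y 2 → u t x = u t y := by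
  intro t ht x y hxy
  have hS : IsSmoothSpaceTimeOn (Iio 0) u := hu.1
  obtain ⟨B, hB⟩ := hu.2.2.2
  have hinner : ∀ w : (EuclideanSpace ℝ (Fin 3)), ⟪w, e3⟫_ℝ = w 2 := fun w => by
    simp [e3, EuclideanSpace.inner_single_right]
  exact planarRigidity_slice ((hS.contDiff_slice ht).of_le (by norm_cast)) (fun z => hB t ht z)
    (hu.2.1 t ht) (fun z => hh t ht z) (fun z => by rw [← hinner]; exact hω t ht z) x y hxy

/-- **B2 DERIVED (REV 5)**: `CurlFreeHorizontalIsConstant` from the smaller stub B2b and the proved B2a. -/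
theorem curlFreeHorizontalIsConstant_of_shearIsConstant (hB2b : ShearIsConstant) :
    CurlFreeHorizontalIsConstant :=
  fun u hu hh hω => hB2b u hu hh (planarRigidity hu hh hω)

/-- Rung 1b from the REV-5 stub set: B1 → B2b ⇒ Row A7hb. -/
theorem row_A7hb_of_stubs' (hB1 : VerticalVorticityVanishesBounded) (hB2b : ShearIsConstant) :
    Row_A7hb :=
  row_A7hb_of_stubs hB1 (curlFreeHorizontalIsConstant_of_shearIsConstant hB2b)

end Summit.NavierStokesRegularity.NavierStokesRegularity.Theorems.ScenarioCensus.HorizontalMeter
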